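import Summits.QuantumFields.YangMills.Theorems.BalabanUVNodesN15PerCubeGreenLandauLetterCut
import Summits.QuantumFields.YangMills.Theorems.BalabanUVNodesN15CovariantLandauMass
import HarnessLib

/-!
# N15 = NE2, road (c) — PROGRAMME (PC), (PC-D) «the per-cube LANDAU LETTER», X: THE DICTIONARY TO THE KNIT's BOND-POINT CONVENTION — n15-c∕260's site fields ∕ `cvT` ∕ r07 `gaugeTr` read
# as n15-c∕181∕201's bond-point fields ∕ `cvT₀` ∕ `cvGauge` ∕ `cvNVr` ∕ `cvChi` ∕ `CvNorm`, and n15-c∕314 restated LITERALLY as the `hNVcut` row of `N_V^R(U^{w_k})` of n15-c∕202∕203's knit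
# (dag-n15-c g29, n15-c∕315)

Cell `pub-ymgap`, seat `pub-ymgap-dag-n15-c` (generation g29; R134 (a), s1; HUMAN RULING D-0062).  `bears_on: R4∕N15 · K3⁸ SpineGivenEndpointR13SepCoPHV (stmt-QuantumFields-27366)`;
filed `--kind proof --supports stmt-QuantumFields-27366 --as helper` — COUNT-NEUTRAL.  Four theorems (three `rfl`-grade dictionary entries, one assembly), 0 `def`, 0 `sorry`.  Imports BY NAME
n15-c∕314 `hasMaj_landauCov_gaugeTr_sub_flat_cut`, n15-c∕210 `cvNVr_eq_of_mass` (the letter `N_V^R` is mass-free), n15-c∕200 `landauCov_one_eq` (`mulVecLin landauCov(𝟙) = landauRe ⊗ 1_ι`),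
n15-c∕201 (`cvT₀`, `cvLandau`, `cvNVr`, `cvGauge`), n15-c∕181 (`CvX`, `CvNorm`, `cvChi`), r07 `gaugeTr` ∕ dag-n15-w2 `uN_val_gaugeTr_eq`.  Nothing in the tree is modified.

WHY.  The per-cube programme (n15-c∕260–314) works with SITE fields `U : J → ScX → U(m)` and the transporter datum `cvT e U`; the knit n15-c∕201∕202∕203 with BOND-POINT fields
`U : J → CvX → M_m(ℂ)` (`CvX = ScX × J`), `cvT₀` (read at the bond's own component), the gauge action `cvGauge`, the letter `cvNVr a ι e U := mulVecLin landauCov(cvT₀ e U) a − landauRe ⊗ 1_ι`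
and the cut `cvChi k`.  For component-blind fields `(μ, p) ↦ U_μ(p.1)` the two conventions agree definitionally (§1); so n15-c∕314 IS the knit's input-cut row of `N_V^R` at the gauged
field, at ANY mass `a > 0` (§2).

WHAT.  §1 `cvT₀_comp_fst` (`cvT₀ e (U ∘ fst) = cvT e U`, `rfl`), `cvGauge_comp_fst_eq_gaugeTr` (`cvGauge (w ∘ fst) (U ∘ fst) = (gaugeTr scShift w U) ∘ fst` for unitary `w`),
`cvNVr_comp_fst_eq` (`cvNVr a (V ∘ fst) = mulVecLin landauCov(cvT e V) a′ − mulVecLin landauCov(𝟙) a′` for unitary `V`, any `a, a′ > 0`).  §2 ★★★★ `hasMaj_cvNVr_cvGauge_cut`: under n15-c∕313's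
hypotheses and `a > 0`, for every cube `k`: `cvNVr a ι e ((U ∘ fst)^{w_k ∘ fst}) ∘ M_{cvChi k} ≤ B·(Σ(r_V) + 2e^{−δL^m})·e^{−δ|z−z′|_T}` in `CvNorm` — the shape of 203's `hNVcut` for the
`R`-part of `N_V k`.

HONEST FRAMING ∕ LIMITS.  Dictionary + assembly of LANDED theorems on MODEL carriers; [B9] (3.26) p.395, (3.28) p.395, (3.49) p.399, (3.59)–(3.60) p.402 cited for SHAPES only.  NE2⁺ NOT
PRINTED, NOT proved; N15 of record untouched (DISCHARGED AS CONSUMED, p687738); K3⁸ OPEN; counts of record UNMOVED; one finite 𝕋⁴ at fixed ε per index — NOT infinite volume, NOT OS on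
ℝ⁴, NOT a mass gap, NOT Clay.  Restate-immune (no Theses import).
-/

noncomputable section

open scoped BigOperators Matrix Matrix.Norms.L2Operator

namespace Summit.QuantumFields.YangMills.BalabanUVNodes.N15.Gluing

open Real
open Literature.MathematicalPhysics.QuantumFieldTheory.Balaban1983to89
open Literature.MathematicalPhysics.QuantumFieldTheory.Balaban1983to89.B5Prop11Plancherel (Tor fine unitVec)
open Literature.MathematicalPhysics.QuantumFieldTheory.Balaban1983to89.B5Block118 (up bpt)
open Literature.MathematicalPhysics.QuantumFieldTheory.Balaban1983to89.B11SectG (BlockNorm HasMaj RowSum)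
open Literature.MathematicalPhysics.QuantumFieldTheory.Balaban1983to89.B6RandomWalk (Triangle254)
open Literature.MathematicalPhysics.QuantumFieldTheory.Balaban1983to89.B6UnitTorusCarrier (unitTorusGeo triangle254_unitTorusGeo rowSum_unitTorusGeo unitTorusGeo_dist_nonneg unitTorusGeo_dist_self)
open Literature.MathematicalPhysics.QuantumFieldTheory.Balaban1983to89.B9Eq335RegularityClasses (Reg335Cube)
open Literature.MathematicalPhysics.QuantumFieldTheory.Balaban1983to89.B9Eq336RegularityClassesOrbit (reg335Cube_gaugeTr)
open Literature.MathematicalPhysics.QuantumFieldTheory.Balaban1983to89.B9Eq3117Current (gaugeTr gaugeTr_one)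
open Literature.MathematicalPhysics.QuantumFieldTheory.Balaban1983to89.B9Eq39Adjoint (covD fluct)
open Summit.QuantumFields.YangMills.BalabanUVNodes.N15.CovLandau (landauCov_one_eq cSop cSop_gauge landauCov landauCov_gauge bdiag bdiag_transpose bdiag_mul_bdiag bdiag_one bdiag_orth bdiag_orth' isUnit_cSop mulVecLin_sub')
open Summit.QuantumFields.YangMills.BalabanUVNodes.N15.BackgroundModel (kappa_ofBlocks)
open Literature.MathematicalPhysics.QuantumFieldTheory.King1986 (aK aK_pos aK_le aK_ge)
open Literature.MathematicalPhysics.QuantumFieldTheory.King1986.Torus (blockOf)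
open Literature.Barriers.QuantumFields (traceForm)
open Summit.QuantumFields.YangMills.BalabanUVNodes.N15.MatrixSpecies (mmulOp coordMat basisConst liftBlk mmulOp_comp_mmulOp)
open Summit.QuantumFields.YangMills.BalabanUVNodes.N15.TwoGrid (cubeBlocks chiCube abs_chiCube_le_one)
open Literature.MathematicalPhysics.QuantumFieldTheory.Balaban1983to89.B6Prop26Gluing (mulOp mulOp_apply ind ind_nonneg)
open Literature.MathematicalPhysics.QuantumFieldTheory.Balaban1983to89.B6UnitTorusCarrier (unitTorusGeo_dist_symm)
open Summit.QuantumFields.YangMills.BalabanUVNodes.N15.CurvedSpecies (uN_val_gaugeTr_eq uN_val_inv_eq_conjTranspose uN_coordMat_conj_orthogonal hasMaj_gaugeConj mmulOp_one)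

variable {d : ℕ}

/-! ## §1 The dictionary (component-blind bond-point fields) -/

section Dictionary

variable {L : ℕ} [NeZero L] {mv kk : ℕ} {hL : Odd L ∧ 1 < L} {mm : Type} [Fintype mm] [DecidableEq mm]

/-- `cvT₀ e (U ∘ fst) = cvT e U`: the bond-point transporter datum of a component-blind field is the site datum. [cite: Balaban1985BackgroundPropagators, (3.23) p.394, (3.50) p.400 (shape)] -/
theorem cvT₀_comp_fst (ι : Type) [Fintype ι] [DecidableEq ι] (e : Matrix mm mm ℂ ≃L[ℝ] (ι → ℝ)) (U : Fin (d + 1) → ScX d L mv kk hL → Matrix mm mm ℂ) :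
    cvT₀ e (fun μ (p : CvX d L mv kk hL) => U μ p.1) = cvT e U := rfl

omit [NeZero L] in
/-- `cvGauge (w ∘ fst) (U ∘ fst) = (U^w) ∘ fst` with r07's `gaugeTr` along the site shifts (unitary `w`: `w⁻¹ = wᴴ`). [cite: Balaban1985BackgroundPropagators, (3.28) p.395 (shape)] -/
theorem cvGauge_comp_fst_eq_gaugeTr {w : ScX d L mv kk hL → (Matrix mm mm ℂ)ˣ} (hw : ∀ x, (w x : Matrix mm mm ℂ) ∈ Matrix.unitaryGroup mm ℂ)
    (U : Fin (d + 1) → ScX d L mv kk hL → (Matrix mm mm ℂ)ˣ) :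
    cvGauge d L mv kk hL (fun p : CvX d L mv kk hL => (w p.1 : Matrix mm mm ℂ)) (fun μ (p : CvX d L mv kk hL) => (U μ p.1 : Matrix mm mm ℂ)) =
      fun μ (p : CvX d L mv kk hL) => (gaugeTr (scShift d L mv kk hL) w U μ p.1 : Matrix mm mm ℂ) := by
  funext μ p
  rw [uN_val_gaugeTr_eq (T := scShift d L mv kk hL) U (hw (scShift d L mv kk hL μ p.1))]
  rfl

/-- `cvNVr a (V ∘ fst) = mulVecLin landauCov(cvT e V) a′ − mulVecLin landauCov(𝟙) a′` for a unitary site field `V` and any masses `a, a′ > 0` (n15-c∕210: `N_V^R` is mass-free; n15-c∕200: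
the flat term is `landauRe ⊗ 1_ι`). [cite: Balaban1985BackgroundPropagators, (3.26) p.395; Balaban1984PropagatorsI, (1.69) p.29 (shapes)] -/
theorem cvNVr_comp_fst_eq (ι : Type) [Fintype ι] [DecidableEq ι] (e : Matrix mm mm ℂ ≃L[ℝ] (ι → ℝ)) {a a' : ℝ} (ha : 0 < a) (ha' : 0 < a')
    {V : Fin (d + 1) → ScX d L mv kk hL → Matrix mm mm ℂ} (hV : ∀ μ x, (V μ x)ᴴ * V μ x = 1) :
    cvNVr d L mv kk hL a ι e (fun μ (p : CvX d L mv kk hL) => V μ p.1) =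
      Matrix.mulVecLin (landauCov (cvM d L mv kk hL) (L ^ kk) (cvT e V) a') - Matrix.mulVecLin (landauCov (cvM d L mv kk hL) (L ^ kk) (fun (_ : Fin (d + 1)) (_ : ScX d L mv kk hL) => (1 : Matrix ι ι ℝ)) a') := by
  rw [cvNVr_eq_of_mass d L mv kk hL ha ha' e (U := fun μ (p : CvX d L mv kk hL) => V μ p.1) (fun ν p => hV ν p.1), cvNVr, cvLandau, landauCov_one_eq (cvM d L mv kk hL) (L ^ kk) ha' ι]
  rfl

end Dictionary

/-! ## §2 n15-c∕314 as the knit's input-cut row of `N_V^R(U^{w_k})` -/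

section Knit

variable {L : ℕ} [NeZero L]

set_option maxHeartbeats 800000 in
/-- ★★★★ **THE `hNVcut` ROW OF `N_V^R` PER CUBE, IN THE KNIT's CONVENTION.**  Under n15-c∕313's hypotheses (`L ≥ 17` odd; unitary site field `U`; (3.35) letters `ξ, C`; unitary cube gauges
`w_k` with (3.35) potentials for `U^{w_k}` on `c(Lw+6w−m₀,k)+[0,Lw+16w+2)^{d+1}`; letters `r_V`, `Σ₀(r_V) ≤ R₀`, `σ(r_V) ≤ R₀`; `L^m ≥ w₀`) and a mass `a > 0`, for every cube `k`:
`cvNVr a ι e (cvGauge (w_k ∘ fst) (U ∘ fst)) ∘ M_{cvChi k} ≤ B·(r_V(1+|J⊕J|) + a_K|ι|(|ι|σ²+2σ) + σ + (L^m)⁻¹ + 2e^{−δL^m})·e^{−δ|z−z′|_T}` in `CvNorm`.  MODEL carriers; the shape of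
[B9] Thm 3.2–3.3's content for the Landau summand as 52's knit asks it. [cite: Balaban1985BackgroundPropagators, (3.49) p.399, Thm 3.4 p.400, (3.59)–(3.60) p.402, Cor. 3.8 p.410 (shapes ∕ mechanism); Balaban1984PropagatorsI, (1.20) p.20] -/
theorem hasMaj_cvNVr_cvGauge_cut (hL : Odd L ∧ 1 < L) (hL17 : 17 ≤ L) {a₀ : ℝ} (ha₀ : 0 < a₀) (ι : Type) [Fintype ι] [DecidableEq ι] {a : ℝ} (ha : 0 < a) :
    ∃ δ w₀ R₀ B : ℝ, 0 < δ ∧ 0 < R₀ ∧ 0 < B ∧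
      ∀ (mv kk : ℕ), 1 ≤ kk → w₀ ≤ ((L ^ mv : ℕ) : ℝ) →
      ∀ {mm : Type} [Fintype mm] [DecidableEq mm] [Nonempty mm] (e : Matrix mm mm ℂ ≃L[ℝ] (ι → ℝ)), (∀ A B : Matrix mm mm ℂ, traceForm A B = e A ⬝ᵥ e B) →
      ∀ (U : Fin (d + 1) → ScX d L mv kk hL → (Matrix mm mm ℂ)ˣ), (∀ μ x, (U μ x : Matrix mm mm ℂ) ∈ Matrix.unitaryGroup mm ℂ) →
      ∀ (ξ C : ℝ), 0 < ξ → 0 < C →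
      ∀ (w : (Fin (d + 1) → ZMod (2 * L)) → ScX d L mv kk hL → (Matrix mm mm ℂ)ˣ), (∀ k x, (w k x : Matrix mm mm ℂ) ∈ Matrix.unitaryGroup mm ℂ) →
        (∀ k : Fin (d + 1) → ZMod (2 * L), ∃ A : Fin (d + 1) → ScX d L mv kk hL → Matrix mm mm ℂ,
          (∀ μ, ∀ z ∈ {x : ScX d L mv kk hL | blockOf (L ^ kk) (cvM d L mv kk hL) x ∈ cubeBlocks (cvM d L mv kk hL) (coverCorner (cvM d L mv kk hL) (L ^ mv) L (L * L ^ mv + 6 * L ^ mv - coverMargin L mv) k) (L * L ^ mv + 16 * L ^ mv + 2)}, gaugeTr (scShift d L mv kk hL) (w k) U μ z = fluct (((((L ^ kk : ℕ) : ℝ))⁻¹)) A μ z) ∧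
          (∀ μ, ∀ z ∈ {x : ScX d L mv kk hL | blockOf (L ^ kk) (cvM d L mv kk hL) x ∈ cubeBlocks (cvM d L mv kk hL) (coverCorner (cvM d L mv kk hL) (L ^ mv) L (L * L ^ mv + 6 * L ^ mv - coverMargin L mv) k) (L * L ^ mv + 16 * L ^ mv + 2)}, ‖A μ z‖ < C * ξ⁻¹) ∧
          (∀ μ ν, ∀ z ∈ {x : ScX d L mv kk hL | blockOf (L ^ kk) (cvM d L mv kk hL) x ∈ cubeBlocks (cvM d L mv kk hL) (coverCorner (cvM d L mv kk hL) (L ^ mv) L (L * L ^ mv + 6 * L ^ mv - coverMargin L mv) k) (L * L ^ mv + 16 * L ^ mv + 2)}, ‖((↑(((((L ^ kk : ℕ) : ℝ))⁻¹)) : ℂ)⁻¹) • covD (scShift d L mv kk hL) (fun _ _ => (1 : (Matrix mm mm ℂ)ˣ)) μ (A ν) z‖ < C * (ξ ^ 2)⁻¹)) →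
      ∀ (rV : ℝ), 0 ≤ rV →
        Fintype.card ι * (@basisConst ι _ (Matrix mm mm ℂ) Matrix.frobeniusNormedAddCommGroup Matrix.frobeniusNormedSpace e * (2 * Real.sqrt (Fintype.card mm)) * (Real.sqrt (Fintype.card mm) * ((C / ξ) * Real.exp (((((L ^ kk : ℕ) : ℝ))⁻¹) * (C / ξ))))) ≤ rV →
        Fintype.card ι * (Fintype.card (Fin (d + 1)) * (Fintype.card ι * (@basisConst ι _ (Matrix mm mm ℂ) Matrix.frobeniusNormedAddCommGroup Matrix.frobeniusNormedSpace e * (2 * Real.sqrt (Fintype.card mm)) * (Real.sqrt (Fintype.card mm) * ((C / ξ) * Real.exp (((((L ^ kk : ℕ) : ℝ))⁻¹) * (C / ξ))))) ^ 2 + @basisConst ι _ (Matrix mm mm ℂ) Matrix.frobeniusNormedAddCommGroup Matrix.frobeniusNormedSpace e * (2 * Real.sqrt (Fintype.card mm)) * (Real.sqrt (Fintype.card mm) * ((C / ξ ^ 2) * Real.exp (((((L ^ kk : ℕ) : ℝ))⁻¹) * (C / ξ)))))) ≤ rV →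
        rV * (1 + Fintype.card (Fin (d + 1) ⊕ Fin (d + 1))) + a₀ * (Fintype.card ι * (Fintype.card ι * ((1 + rV * ((((L ^ kk : ℕ) : ℝ))⁻¹)) ^ ((d + 1) * L ^ kk) - 1) ^ 2 + 2 * ((1 + rV * ((((L ^ kk : ℕ) : ℝ))⁻¹)) ^ ((d + 1) * L ^ kk) - 1))) ≤ R₀ →
        ((1 + rV * ((((L ^ kk : ℕ) : ℝ))⁻¹)) ^ ((d + 1) * L ^ kk) - 1) ≤ R₀ →
      ∀ k : Fin (d + 1) → ZMod (2 * L),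
        HasMaj (CvNorm d L mv kk hL ι) (CvNorm d L mv kk hL ι)
          (cvNVr d L mv kk hL a ι e (cvGauge d L mv kk hL (fun p : CvX d L mv kk hL => (w k p.1 : Matrix mm mm ℂ)) (fun μ (p : CvX d L mv kk hL) => (U μ p.1 : Matrix mm mm ℂ))) ∘ₗ mulOp (fun q : CvX d L mv kk hL × ι => cvChi d L mv kk hL k q.1))
          (fun z z' => B * (rV * (1 + Fintype.card (Fin (d + 1) ⊕ Fin (d + 1))) + aK a₀ (L : ℝ) kk * (Fintype.card ι * (Fintype.card ι * ((1 + rV * ((((L ^ kk : ℕ) : ℝ))⁻¹)) ^ ((d + 1) * L ^ kk) - 1) ^ 2 + 2 * ((1 + rV * ((((L ^ kk : ℕ) : ℝ))⁻¹)) ^ ((d + 1) * L ^ kk) - 1))) + ((1 + rV * ((((L ^ kk : ℕ) : ℝ))⁻¹)) ^ ((d + 1) * L ^ kk) - 1) + (((L ^ mv : ℕ) : ℝ))⁻¹ + 2 * Real.exp (-(δ * ((L ^ mv : ℕ) : ℝ)))) * Real.exp (-(δ * (unitTorusGeo L kk (cvM d L mv kk hL)).dist z z'))) := by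
  classical
  obtain ⟨δ₀, w₀, R₀, B₀, hδ₀, hR₀, hB₀, H⟩ := hasMaj_landauCov_gaugeTr_sub_flat_cut (d := d) hL hL17 ha₀ ι
  refine ⟨δ₀, w₀, R₀, B₀, hδ₀, hR₀, hB₀, fun mv kk hk hw => ?_⟩
  intro mm _ _ _ e he U hU ξ C hξ hC w hwU hdat rV hrV hrA hrC hRle hσV k
  have hL1r : (1 : ℝ) < (L : ℝ) := by exact_mod_cast hL.2
  have hnpos : (0 : ℝ) < (((L ^ kk : ℕ) : ℝ)) ^ (d + 1) := by positivity
  have ha' : 0 < (aK a₀ (L : ℝ) kk * (((L ^ kk : ℕ) : ℝ)) ^ (d + 1)) := mul_pos (aK_pos ha₀ hL1r hk) hnpos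
  have hu : ∀ x, (w k x : Matrix mm mm ℂ) ∈ Matrix.unitaryGroup mm ℂ := hwU k
  have hVu : ∀ μ x, (gaugeTr (scShift d L mv kk hL) (w k) U μ x : Matrix mm mm ℂ) ∈ Matrix.unitaryGroup mm ℂ := fun μ x => by
    rw [uN_val_gaugeTr_eq (T := scShift d L mv kk hL) U (hu (scShift d L mv kk hL μ x))]
    exact Submonoid.mul_mem _ (Submonoid.mul_mem _ (hu x) (hU μ x)) (Unitary.star_mem (hu (scShift d L mv kk hL μ x)))
  have hV' : ∀ μ x, ((gaugeTr (scShift d L mv kk hL) (w k) U μ x : Matrix mm mm ℂ))ᴴ * (gaugeTr (scShift d L mv kk hL) (w k) U μ x : Matrix mm mm ℂ) = 1 :=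
    fun μ x => Matrix.mem_unitaryGroup_iff'.mp (hVu μ x)
  have e1 : cvNVr d L mv kk hL a ι e (cvGauge d L mv kk hL (fun p : CvX d L mv kk hL => (w k p.1 : Matrix mm mm ℂ)) (fun μ (p : CvX d L mv kk hL) => (U μ p.1 : Matrix mm mm ℂ))) = Matrix.mulVecLin (landauCov (cvM d L mv kk hL) (L ^ kk) (cvT e (fun μ x => (gaugeTr (scShift d L mv kk hL) (w k) U μ x : Matrix mm mm ℂ))) (aK a₀ (L : ℝ) kk * (((L ^ kk : ℕ) : ℝ)) ^ (d + 1))) - Matrix.mulVecLin (landauCov (cvM d L mv kk hL) (L ^ kk) (fun (_ : Fin (d + 1)) (_ : ScX d L mv kk hL) => (1 : Matrix ι ι ℝ)) (aK a₀ (L : ℝ) kk * (((L ^ kk : ℕ) : ℝ)) ^ (d + 1))) := by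
    rw [cvGauge_comp_fst_eq_gaugeTr (hwU k) U]
    exact cvNVr_comp_fst_eq ι e ha ha' (V := (fun μ x => (gaugeTr (scShift d L mv kk hL) (w k) U μ x : Matrix mm mm ℂ))) hV'
  rw [e1]
  exact H mv kk hk hw e he U hU ξ C hξ hC w hwU hdat rV hrV hrA hrC hRle hσV k

end Knit

end Summit.QuantumFields.YangMills.BalabanUVNodes.N15.Gluing

end
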